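/-
Copyright (c) 2026. All rights reserved.
Released under Apache 2.0 license as described in the file LICENSE.
-/
import Literature.NumberTheory.Automorphic.QuaternionicSIdealClassesAdmissible
import HarnessLib

/-!
# Sign spaces at the ramified primes, arithmetically: `2^{#T} dim M^χ(O) = ∑_g χ(g) · #{[I] : O_L(I) ∋ x, nrd x = d_g}`
# (Martin's Prop. 12 with the traces `tr T(d)` of the Brandt matrices at `d ∣ N⁻` counted by reduced norms)

[tag: quaternion_algebra] [tag: eichler_order] [tag: hecke_operator]

Topic `NumberTheory/Automorphic`. Lane `lit-hodgefound`, seat p12, gen 52 — sequel of `BrandtModuleSignSpaceDimension.lean`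
(`2^{#T} dim M^χ(O) = ∑_g χ(g) #Fix(Φ_T g)`) and of `BrandtMatrixRamifiedDivisors.lean` (`T(d)`, `d ∣ N⁻`, is the
permutation matrix of `[I] ↦ [I 𝔓_{q₁} ⋯ 𝔓_{q_s}]` and `tr T(d) = #{c : O_L(I_c) ∋ x, nrd x = d}`).

When `T` is a set of RAMIFIED primes (`T ⊆` primes of `N⁻`; Martin's setting: `S` a set of primes dividing the
discriminant `𝔑`), the element `g ∈ (ℤ/2ℤ)^T` acts on `Cls O` by `[I] ↦ [I ∏_{q ∈ supp g} 𝔓_q]`, i.e. by the permutation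
underlying the Brandt matrix `T(d_g)`, `d_g = ∏_{q ∈ supp g} q` (DEFINITION `divisorOf`, §1 — the divisor `d ∣ M` indexing
Martin's sum `∑_{d ∣ M} ε_M(d) tr W_d` [Martin2018RefinedDimensions, Prop. 12]). Consequently, for every Brandt setup
(every Eichler order `O` of level `N⁺` in the definite quaternion algebra of discriminant `N⁻` over `ℚ`):

* §1 `divisorOf_one`, `divisorOf_mulSingle` (`d_{e_r} = r`), `divisorOf_dvd` (`d_g ∣ N⁻`);
* §2 ★ **`matrix_divisorOf_apply`** (`T(d_g)_{c c'} = [c = Φ_T(g) c']`: the Brandt matrix `T(d_g)` is the permutation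
  matrix of `Φ_T(g)`), **`trace_matrix_divisorOf`** (`tr T(d_g) = #Fix(Φ_T g)`),
  ★ **`natCard_fixedPoints_atkinLehnerHom_eq_natCard_represents`** (`#Fix(Φ_T g) = #{c : ∃ x ∈ O_L(I_c), nrd x = d_g}`);
* §3 ★★★ **`two_pow_mul_finrank_signSpace_eq_sum_natCard_represents`** — for `T ⊆` primes of `N⁻` and every `χ`:
  `2^{#T} · dim M^χ(O) = ∑_{g ∈ (ℤ/2ℤ)^T} χ(g) · #{c ∈ Cls O : O_L(I_c) contains an element of reduced norm d_g}`
  (Martin's `dim S^{ε_M} = 2^{−ω(M)} ∑_{d ∣ M} ε_M(d) tr W_d` with Eichler's `tr B(d) = ∑_i #{principal two-sided ideals of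
  O_i of norm d}`), **`two_pow_mul_natCard_sClassSet_eq_sum_natCard_represents`** (`χ = +`: Martin's `S`-ideal class
  number `2^{#T} h_T = ∑_g #{c : O_L(I_c) ∋ x, nrd x = d_g}`), `two_pow_mul_natCard_isAdmissible_eq_sum_natCard_represents`,
  and the one-prime case **`two_mul_finrank_signSpace_singleton_eq`** (`2 dim M^{χ}_{{q}}(O) = h + χ_q #{c : O_L(I_c) ∋ x,
  nrd x = q}`, [Martin2018, (4.4)] with `h − 2 s_q` = the number of `[I]` whose left order has an element of norm `q`).

## References

* [Martin2018RefinedDimensions] K. Martin, *Refined dimensions of cusp forms, and equidistribution and bias of signs*,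
  J. Number Theory 188 (2018), §3 Prop. 12 (`dim S_k^{new,ε_M}(N) = 2^{−ω(M)} ∑_{d∣M} ε_M(d) tr W_d`).
* [Martin2018] K. Martin, *Congruences for modular forms mod 2 and quaternionic `S`-ideal classes*, Canad. J. Math. 70
  (2018): §2, §4.1 (`σ_𝔭([x]) = [x ϖ_{B_𝔭}]`), §4.3 (4.4).
* [VignerasLNM800] M.-F. Vignéras, *Arithmétique des algèbres de quaternions*, LNM 800 (1980), Ch. III §5 exercice 5.8,
  Ch. V §2 (trace des matrices de Brandt: the diagonal of `P(A)` counts principal two-sided ideals).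
* [Voight2021] J. Voight, *Quaternion Algebras*, GTM 288 (2021): (30.9.3)–(30.9.4), Cor. 18.5.12.

## Scope (honest)

Only the RAMIFIED involutions `W_{q⁻}` are made arithmetic here (`T ⊆` primes of `N⁻`); for the level involutions `W_{p⁺}`
(`p ∣ N⁺`) the fixed classes are those whose left order has a principal Atkin–Lehner ideal, which is not counted by
reduced norms alone and is not treated. Weight `0`, `F = ℚ`. One definition (`divisorOf`), theorems otherwise; no named
fact, no instance.
-/

noncomputable section

open scoped Pointwise

namespace Literature.NumberTheory.Automorphic

namespace Brandt

/-! ## §1 The divisor `d_g` of a sign-group element -/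

section Divisor

variable (T : Finset ℕ)

/-- The two elements of `ℤ/2ℤ` (multiplicative notation). [folklore] -/
private theorem eq_one_or_eq_ofAdd_one₄ (z : Multiplicative (ZMod 2)) : z = 1 ∨ z = Multiplicative.ofAdd 1 := by
  revert z; decide

/-- `ofAdd 1 ≠ 1` in `ℤ/2ℤ`. [folklore] -/
private theorem ofAdd_one_ne_one₄ : Multiplicative.ofAdd (1 : ZMod 2) ≠ 1 := by decide

/-- **The divisor `d_g = ∏_{r ∈ supp g} r` of an element `g` of the sign group `(ℤ/2ℤ)^T`** (the divisor `d ∣ M` of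
Martin's sum `∑_{d ∣ M} ε_M(d) tr W_d`: subsets of the primes of `M` ↔ divisors of the squarefree `M`).
[cite: Martin2018RefinedDimensions, §3 Prop. 12] -/
def divisorOf (g : T → Multiplicative (ZMod 2)) : ℕ := ∏ r : T, if g r = 1 then 1 else (r : ℕ)

/-- Unfolding `d_g`. [cite: Martin2018RefinedDimensions, §3 Prop. 12] -/
theorem divisorOf_apply (g : T → Multiplicative (ZMod 2)) : divisorOf T g = ∏ r : T, if g r = 1 then 1 else (r : ℕ) :=
  rfl

/-- `d_1 = 1`. [cite: Martin2018RefinedDimensions, §3 Prop. 12 (`W_1` means the identity operator)] -/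
theorem divisorOf_one : divisorOf T 1 = 1 := by
  rw [divisorOf_apply]
  exact Finset.prod_eq_one fun r _ => by rw [Pi.one_apply, if_pos rfl]

/-- `d_{e_r} = r`. [cite: Martin2018RefinedDimensions, §3 Prop. 12] -/
theorem divisorOf_mulSingle (r : T) : divisorOf T (Pi.mulSingle r (Multiplicative.ofAdd 1)) = r := by
  classical
  rw [divisorOf_apply, Finset.prod_eq_single r]
  · rw [Pi.mulSingle_eq_same, if_neg ofAdd_one_ne_one₄]
  · intro r' _ hr'
    rw [Pi.mulSingle_eq_of_ne hr', if_pos rfl]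
  · intro h; exact absurd (Finset.mem_univ r) h

/-- `d_g` divides the product of the members of `T`. [folklore] -/
private theorem divisorOf_dvd_prod (g : T → Multiplicative (ZMod 2)) : divisorOf T g ∣ ∏ n ∈ T, n := by
  rw [divisorOf_apply, ← Finset.prod_coe_sort T]
  exact Finset.prod_dvd_prod_of_dvd _ _ fun r _ => by
    split_ifs
    · exact one_dvd _
    · exact dvd_rfl

/-- **`d_g ∣ N⁻` when `T` consists of primes of `N⁻`** (`N⁻` squarefree). [cite: Martin2018, §2 (`S` a set of primes dividing `𝔑`)] -/
theorem divisorOf_dvd {Nminus : ℕ} (hN : Squarefree Nminus) (hT : T ⊆ Nminus.primeFactors)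
    (g : T → Multiplicative (ZMod 2)) : divisorOf T g ∣ Nminus := by
  refine (divisorOf_dvd_prod T g).trans ((Finset.prod_dvd_prod_of_subset _ _ _ hT).trans ?_)
  rw [Nat.prod_primeFactors_of_squarefree hN]

/-- A partial product over a subset `s` of the coordinates: `d` of `∏_{i ∈ s} e_i^{g_i}`. [folklore] -/
private theorem divisorOf_prod_mulSingle [DecidableEq T] (g : T → Multiplicative (ZMod 2)) (s : Finset T) :
    divisorOf T (∏ i ∈ s, Pi.mulSingle i (g i)) = ∏ i ∈ s, if g i = 1 then 1 else (i : ℕ) := by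
  rw [divisorOf_apply]
  have happ : ∀ r : T, (∏ i ∈ s, Pi.mulSingle (M := fun _ : T => Multiplicative (ZMod 2)) i (g i)) r =
      if r ∈ s then g r else 1 := fun r => by
    rw [Finset.prod_apply]
    split_ifs with hr
    · rw [Finset.prod_eq_single r]
      · rw [Pi.mulSingle_eq_same]
      · intro i _ hir; rw [Pi.mulSingle_eq_of_ne (Ne.symm hir)]
      · intro h; exact absurd hr h
    · exact Finset.prod_eq_one fun i hi => by rw [Pi.mulSingle_eq_of_ne (by rintro rfl; exact hr hi)]
  simp_rw [happ]
  rw [← Finset.prod_filter_mul_prod_filter_not Finset.univ (fun r => r ∈ s)]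
  have h1 : ∏ r ∈ Finset.univ.filter (fun r : T => ¬ r ∈ s), (if (if r ∈ s then g r else 1) = 1 then 1 else (r : ℕ)) = 1 :=
    Finset.prod_eq_one fun r hr => by
      rw [Finset.mem_filter] at hr
      rw [if_neg hr.2, if_pos rfl]
  rw [h1, mul_one]
  have h2 : Finset.univ.filter (fun r : T => r ∈ s) = s := by ext r; simp
  rw [h2]
  exact Finset.prod_congr rfl fun r hr => by rw [if_pos hr]

end Divisor

/-! ## §2 `T(d_g)` is the permutation matrix of `Φ_T(g)` -/

variable {Nplus Nminus : ℕ} (S : XiSetup Nplus Nminus) {T : Finset ℕ} (hT : T ⊆ Nminus.primeFactors)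
include hT

/-- The members of `T` are primes dividing `N⁻`. [folklore] -/
private theorem prime_and_dvd_of_mem (r : T) : (r : ℕ).Prime ∧ (r : ℕ) ∣ Nminus :=
  ⟨Nat.prime_of_mem_primeFactors (hT r.2), Nat.dvd_of_mem_primeFactors (hT r.2)⟩

open Classical in
/-- **`T(d_g)_{c c'} = [c = Φ_T(g) c']` for `T ⊆` primes of `N⁻`**: the Brandt matrix at the divisor `d_g ∣ N⁻` is the
permutation matrix of the sign-group element `g` acting by `[I] ↦ [I ∏_{q ∈ supp g} 𝔓_q]` (coprime multiplicativity
`T(d q) = T(d) T(q)` and `T(q)` = permutation matrix of `W_{q⁻}`). [cite: VignerasLNM800, Ch. III §5 exercice 5.8 (b)–(c)] [cite: Martin2018, §4.1] -/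
theorem XiSetup.matrix_divisorOf_apply [Fintype (ClassSet S.O)] (g : T → Multiplicative (ZMod 2)) (c c' : ClassSet S.O) :
    matrix S.O (divisorOf T g) c c' = if c = S.atkinLehnerHom T g c' then 1 else 0 := by
  -- induct over the support of `g`
  suffices key : ∀ (s : Finset T) (c c' : ClassSet S.O),
      matrix S.O (divisorOf T (∏ i ∈ s, Pi.mulSingle i (g i))) c c' =
        if c = S.atkinLehnerHom T (∏ i ∈ s, Pi.mulSingle i (g i)) c' then 1 else 0 by
    have := key Finset.univ c c'
    rwa [Finset.univ_prod_mulSingle] at this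
  intro s
  induction s using Finset.induction_on with
  | empty =>
    intro c c'
    rw [Finset.prod_empty, divisorOf_one, map_one, Equiv.Perm.coe_one, id_eq, Brandt.matrix_one S.O, Matrix.one_apply]
  | @insert j s hj ih =>
    intro c c'
    rcases eq_one_or_eq_ofAdd_one₄ (g j) with h | h
    · -- `g_j = 0`: nothing changes
      have e : (∏ i ∈ insert j s, Pi.mulSingle (M := fun _ : T => Multiplicative (ZMod 2)) i (g i)) =
          ∏ i ∈ s, Pi.mulSingle i (g i) := by
        rw [Finset.prod_insert hj, h, Pi.mulSingle_one, one_mul]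
      rw [e]
      exact ih c c'
    · -- `g_j = 1`: `d_{insert} = d_s · j`, `T(d_s j) = T(d_s) T(j)`
      have hdiv : divisorOf T (∏ i ∈ insert j s, Pi.mulSingle i (g i)) =
          divisorOf T (∏ i ∈ s, Pi.mulSingle i (g i)) * (j : ℕ) := by
        rw [divisorOf_prod_mulSingle, divisorOf_prod_mulSingle, Finset.prod_insert hj, h, if_neg ofAdd_one_ne_one₄,
          mul_comm]
      have hjp := prime_and_dvd_of_mem hT j
      haveI : Fact (j : ℕ).Prime := ⟨hjp.1⟩
      -- coprimality of `d_s` and `j`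
      have hcop : Nat.Coprime (divisorOf T (∏ i ∈ s, Pi.mulSingle i (g i))) (j : ℕ) := by
        rw [divisorOf_prod_mulSingle]
        refine Nat.Coprime.prod_left fun i hi => ?_
        split_ifs
        · exact Nat.coprime_one_left _
        · refine (Nat.coprime_primes (prime_and_dvd_of_mem hT i).1 hjp.1).mpr fun e => hj ?_
          rwa [← Subtype.ext e]
      rw [hdiv, S.matrix_mul_of_coprime hcop, Matrix.mul_apply]
      simp_rw [ih, S.matrix_ramified_apply_of_dvd hjp.2]
      simp only [mul_ite, mul_one, mul_zero, Finset.sum_ite_eq', Finset.mem_univ, if_true]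
      -- `Φ(∏_{insert}) c' = Φ(∏_s) (W_j c')`
      have e : S.atkinLehnerHom T (∏ i ∈ insert j s, Pi.mulSingle i (g i)) c' =
          S.atkinLehnerHom T (∏ i ∈ s, Pi.mulSingle i (g i)) (S.wMinus j hjp.2 c') := by
        rw [Finset.prod_insert hj, mul_comm, map_mul, Equiv.Perm.coe_mul, Function.comp_apply, h,
          S.atkinLehnerHom_mulSingle, S.atkinLehner_of_dvd hjp.2]
      rw [e]

/-- **`tr T(d_g) = #Fix(Φ_T g)`** (`T ⊆` primes of `N⁻`). [cite: VignerasLNM800, Ch. V §2] [cite: Voight2021, (30.9.3)–(30.9.4)] -/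
theorem XiSetup.trace_matrix_divisorOf [Fintype (ClassSet S.O)] (g : T → Multiplicative (ZMod 2)) :
    (matrix S.O (divisorOf T g)).trace = Nat.card {c : ClassSet S.O // S.atkinLehnerHom T g c = c} := by
  classical
  rw [Matrix.trace, Nat.card_eq_fintype_card, Fintype.card_subtype, Finset.natCast_card_filter]
  refine Finset.sum_congr rfl fun c _ => ?_
  rw [Matrix.diag_apply, S.matrix_divisorOf_apply hT g c c]
  by_cases h : S.atkinLehnerHom T g c = c
  · rw [if_pos h.symm, if_pos h]
  · rw [if_neg (fun h' => h h'.symm), if_neg h]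

/-- **`#Fix(Φ_T g) = #{c ∈ Cls O : O_L(I_c) contains an element of reduced norm d_g}`** for `T ⊆` primes of `N⁻`:
a class is fixed by `[I] ↦ [I 𝔓_{q₁} ⋯ 𝔓_{q_s}]` iff the two-sided ideal `I 𝔓_{q₁} ⋯ 𝔓_{q_s} I⁻¹` of `O_L(I)` is
principal, iff `O_L(I)` has an element of reduced norm `q₁ ⋯ q_s`. [cite: Voight2021, Prop. 30.9.2 (proof) and (30.9.3)] [cite: VignerasLNM800, Ch. V §2 (diagonale de `P(A)`)] -/
theorem XiSetup.natCard_fixedPoints_atkinLehnerHom_eq_natCard_represents (g : T → Multiplicative (ZMod 2)) :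
    Nat.card {c : ClassSet S.O // S.atkinLehnerHom T g c = c} =
      Nat.card {c : ClassSet S.O // ∃ x ∈ leftOrder c.rep, reducedNorm ℚ S.D x = (divisorOf T g : ℕ)} := by
  classical
  haveI : Fintype (ClassSet S.O) := Fintype.ofFinite _
  have h1 := S.trace_matrix_divisorOf hT g
  have h2 := S.trace_matrix_of_dvd_discr (divisorOf_dvd T S.squarefree hT g)
  rw [h1] at h2
  exact_mod_cast h2

/-! ## §3 The arithmetic dimension formula -/

/-- **`2^{#T} · dim M^χ(O) = ∑_{g ∈ (ℤ/2ℤ)^T} χ(g) · #{c ∈ Cls O : O_L(I_c) ∋ x, nrd x = d_g}` for every set `T` of primes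
of the discriminant `N⁻`, every sign pattern `χ` and every Eichler order `O` of level `N⁺`** in the definite quaternion
algebra of discriminant `N⁻` over `ℚ` — Martin's Proposition 12 (`dim S_k^{new,ε_M}(N) = 2^{−ω(M)} ∑_{d ∣ M} ε_M(d) tr W_d`)
on the Brandt module with the traces of the Brandt matrices `T(d)`, `d ∣ N⁻`, counted by reduced norms in the left orders.
[cite: Martin2018RefinedDimensions, §3 Prop. 12] [cite: VignerasLNM800, Ch. V §2] [cite: Voight2021, (30.9.3)] -/
theorem XiSetup.two_pow_mul_finrank_signSpace_eq_sum_natCard_represents (χ : T → ℤˣ) :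
    (2 : ℚ) ^ T.card * Module.finrank ℚ (S.signSpace T χ) =
      ∑ g : T → Multiplicative (ZMod 2), ((signCharacter T χ g : ℤ) : ℚ) *
        Nat.card {c : ClassSet S.O // ∃ x ∈ leftOrder c.rep, reducedNorm ℚ S.D x = (divisorOf T g : ℕ)} := by
  rw [S.two_pow_mul_finrank_signSpace_eq_sum T χ]
  exact Finset.sum_congr rfl fun g _ => by rw [S.natCard_fixedPoints_atkinLehnerHom_eq_natCard_represents hT g]

/-- **`2^{#T} · h_T = ∑_{g} #{c ∈ Cls O : O_L(I_c) ∋ x, nrd x = d_g}`**: Martin's `S`-ideal class number through norm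
counts, for every set `T` of ramified primes (at `T` = all primes of `N⁻` and `N⁺ = 1` this is
`2^{ω(N⁻)} #Typ O = ∑_{d ∣ N⁻} #{c : O_L(I_c) ∋ x, nrd x = d}`, `BrandtMatrixRamifiedDivisors`).
[cite: Martin2018, §2 (`h_{B,S}`) and (3.9)] [cite: Voight2021, (30.9.3) and Cor. 18.5.12] -/
theorem XiSetup.two_pow_mul_natCard_sClassSet_eq_sum_natCard_represents :
    2 ^ T.card * Nat.card (S.SClassSet T) =
      ∑ g : T → Multiplicative (ZMod 2),
        Nat.card {c : ClassSet S.O // ∃ x ∈ leftOrder c.rep, reducedNorm ℚ S.D x = (divisorOf T g : ℕ)} := by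
  classical
  haveI : Fintype (ClassSet S.O) := Fintype.ofFinite _
  rw [← S.sum_natCard_fixedPoints_atkinLehnerHom T]
  exact Finset.sum_congr rfl fun g _ => S.natCard_fixedPoints_atkinLehnerHom_eq_natCard_represents hT g

/-- **`2^{#T} · #Cl_T(O)^{χ-adm} = ∑_g χ(g) · #{c : O_L(I_c) ∋ x, nrd x = d_g}`** (Prop. 7 with the arithmetic traces).
[cite: Martin2018, §4.4 Prop. 7] [cite: Martin2018RefinedDimensions, §3 Prop. 12] -/
theorem XiSetup.two_pow_mul_natCard_isAdmissible_eq_sum_natCard_represents (χ : T → ℤˣ) :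
    (2 : ℚ) ^ T.card * Nat.card {X : S.SClassSet T // S.IsAdmissible T χ X} =
      ∑ g : T → Multiplicative (ZMod 2), ((signCharacter T χ g : ℤ) : ℚ) *
        Nat.card {c : ClassSet S.O // ∃ x ∈ leftOrder c.rep, reducedNorm ℚ S.D x = (divisorOf T g : ℕ)} := by
  rw [← S.finrank_signSpace_eq_natCard_isAdmissible χ]
  exact S.two_pow_mul_finrank_signSpace_eq_sum_natCard_represents hT χ

omit hT in
/-- **One ramified prime: `2 dim M^χ_{{q}}(O) = h + χ_q · #{c : O_L(I_c) ∋ x, nrd x = q}`** (`q ∣ N⁻` prime) — Martin's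
(4.4) `dim M_0^{+_𝔭} = h − s_𝔭`, `dim M_0^{−_𝔭} = s_𝔭` with `h − 2 s_𝔭 = #Fix(σ_𝔭)` counted by the left orders
containing an element of reduced norm `q`. [cite: Martin2018, §4.3 (4.4)] [cite: Voight2021, (30.9.3)] -/
theorem XiSetup.two_mul_finrank_signSpace_singleton_eq {q : ℕ} [hq : Fact q.Prime] (hqN : q ∣ Nminus)
    (χ : ({q} : Finset ℕ) → ℤˣ) :
    (2 : ℚ) * Module.finrank ℚ (S.signSpace {q} χ) =
      Nat.card (ClassSet S.O) + ((χ ⟨q, Finset.mem_singleton_self q⟩ : ℤ) : ℚ) *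
        Nat.card {c : ClassSet S.O // ∃ x ∈ leftOrder c.rep, reducedNorm ℚ S.D x = (q : ℕ)} := by
  rw [S.two_mul_finrank_signSpace_singleton q χ]
  congr 2
  have e : Nat.card {c : ClassSet S.O // S.atkinLehner q c = c} = Nat.card {c : ClassSet S.O // S.wMinus q hqN c = c} :=
    Nat.card_congr (Equiv.subtypeEquivRight fun c => by rw [S.atkinLehner_of_dvd hqN])
  rw [e]
  exact_mod_cast congrArg (Nat.cast (R := ℚ))
    (Nat.card_congr (Equiv.subtypeEquivRight fun c => S.wMinus_eq_self_iff hqN c))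

end Brandt

end Literature.NumberTheory.Automorphic
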